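import Summits.QuantumFields.YangMills.Theorems.FlatTubeReductionTubeMagneticSecondDifference
import Summits.QuantumFields.YangMills.Theorems.FlatTubeReductionDiagonalMomentPointwise
import HarnessLib

/-!
# The second-order part of the diagonal Laplace exponent WITHOUT `u`-independent junk: `|X − X₁| ≤ β·[O(τ_u²) + O(σ) + O(√σ·τ²) + O(τ_u·τ³)]`
# (route `FlatTubeReduction`, crux K1 `NearFlatRatioLaw` stmt-QuantumFields-24720; seat `ym-line-ftr-p1` g13; rate twin «ratepack-v3 / frozen fibres»; R2b1 RECORD rung — no summit
# statement is proved here)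

WHY (memo `Cruxes/NearFlatRatioLaw/Lines/ratepack-v3-frozen-g12.md` §6).  Lane A's `abs_diagX_sub_diagX1_le` bounds the magnetic remainders at `u` and at `1` separately
(`… + stepActionErr τ σ + stepActionErr τ 0`), leaving the `u`-independent junk `β·N_P·(2·29376τ³ + 2·700569τ⁴)` whose Gaussian moment `O(β^{-1/2})` is fatal at rate grade.
With `…TubeMagneticSecondDifference.abs_wilsonAction_orthoTube_second_diff` the two remainders are subtracted first:
* ★★ `abs_diagX_sub_diagX1_le'` — for `|v_{e,c}|, |v'_{e,c}| ≤ τ ≤ 1/30`, `L³S₁(u) ≤ σ < 2`, `|u⃗_{k,a}| ≤ τ_u ≤ 1/40`: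
  `|diagX − diagX1(slowLin u)| ≤ β·48Σ_e‖u⃗_k‖²‖g⃗_y‖‖M⃗_e‖ + (β/2)Σ_{w ∈ {v,v'}}[(σ/2)‖D_u ŵ‖² + N_P(1728τ²√σ + (σ/2)(29376τ³ + 700569τ⁴) + 700000τ_uτ³) + 1.45·10⁸Nτ_u²‖ŵ‖²]`
  — every term carries `τ_u`, `σ` or `√σ` (and `σ ≥ L³S₁(u) = O(τ_u⁴)` on the window);
* ★ `abs_diagX_conj_sub_diagX1_le_E2'` — the same uniformly over the colour rotation `u ↦ dud⁻¹` (rotation-invariant size `Σ_a u⃗_{k,a}² ≤ τ_u²`), the `E₂'(p)` weight of the moment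
  machine (`…DiagonalMomentPointwise.haarMoment2_le` / `haarMomentR_le` take any uniform bound).
HONEST FRAMING: bookkeeping of landed exact identities for a stub of a child of the CONDITIONAL reduction route R2b1; femto rung R2b1 (RECORD label); not infinite volume, not a gap,
not Clay.  No defs, no named facts, no `sorry`.
-/

set_option autoImplicit false

noncomputable section

open MeasureTheory Filter Topology Real
open scoped BigOperators Matrix InnerProductSpace RealInnerProductSpace
open Literature.MathematicalPhysics.QuantumFieldTheory
open Literature.MathematicalPhysics.QuantumLattice

namespace Summit.QuantumFields.YangMills.Theorems.FemtoTransferGap.RateTube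

open Summit.QuantumFields.YangMills.Theorems.FemtoTransferGap
open Summit.QuantumFields.YangMills.Theorems.FemtoTransferGap.TwoLattice
open Summit.QuantumFields.YangMills.Theorems.FemtoTransferGap.TwoLattice.Stiff
open Summit.QuantumFields.YangMills.Theorems.FemtoTransferGap.TwoLattice.Cov
open Summit.QuantumFields.YangMills.Theorems.FemtoTransferGap.TwoLattice.ConstTube
open Summit.QuantumFields.YangMills.Theorems.FemtoTransferGap.TwoLattice.Toron
open Summit.QuantumFields.YangMills.Theorems.FemtoTransferGap.TwoLattice.Avg

variable {L : ℕ} [NeZero L]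

/-! ## §1 ★★ The junk-free second-order remainder -/

set_option maxHeartbeats 800000 in
/-- ★★ **`|diagX − diagX1(slowLin u)|` WITHOUT `u`-INDEPENDENT JUNK** on the cap, for `|v_{e,c}|, |v'_{e,c}| ≤ τ ≤ 1/30`, `L³S₁(u) ≤ σ < 2`, `|u⃗_{k,a}| ≤ τ_u ≤ 1/40`, `β ≥ 0`:
the magnetic remainders at `u` and at `1` are subtracted by `abs_wilsonAction_orthoTube_second_diff`, so every term of the bound carries `τ_u`, `σ` or `√σ`. [cite: Luscher1983, §3] -/
theorem abs_diagX_sub_diagX1_le' {β : ℝ} (hβ : 0 ≤ β) (u : GaugeConfig 3 1 SU2) {v v' : Edge 3 L → Fin 3 → ℝ} (hv : v ∈ capBalancedSet L) (hv' : v' ∈ capBalancedSet L)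
    {τ σ τu : ℝ} (hτ : τ ≤ 1 / 30) (hσ : σ < 2) (hS : (L : ℝ) ^ 3 * wilsonAction su2Rep u ≤ σ) (hvτ : ∀ (e : Edge 3 L) (c : Fin 3), |v e c| ≤ τ)
    (hvτ' : ∀ (e : Edge 3 L) (c : Fin 3), |v' e c| ≤ τ) (hτu : τu ≤ 1 / 40) (hu : ∀ (k : Fin 3) (a : Fin 3), |vecPart (u (0, k)) a| ≤ τu) (g : Site 3 L → SU2) :
    |diagX L β u v v' g - diagX1 L β (slowLin u) v v' g| ≤
      β * (48 * ∑ e : Edge 3 L, ‖vecPart (u (0, e.2))‖ ^ 2 * ‖vecPart (g (e.1.shift e.2))‖ * ‖vecPart (linkM L v v' g e)‖) +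
      β / 2 * (σ / 2 * ‖covCurl (constLift L u) (linkEmbed L v)‖ ^ 2 +
        (Fintype.card (Plaquette 3 L) : ℝ) * (1728 * τ ^ 2 * Real.sqrt σ + σ / 2 * (29376 * τ ^ 3 + 700569 * τ ^ 4) + 700000 * τu * τ ^ 3) +
        145000000 * (Fintype.card (Plaquette 3 L × Fin 3) : ℝ) * τu ^ 2 * ‖linkEmbed L v‖ ^ 2) +
      β / 2 * (σ / 2 * ‖covCurl (constLift L u) (linkEmbed L v')‖ ^ 2 +
        (Fintype.card (Plaquette 3 L) : ℝ) * (1728 * τ ^ 2 * Real.sqrt σ + σ / 2 * (29376 * τ ^ 3 + 700569 * τ ^ 4) + 700000 * τu * τ ^ 3) +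
        145000000 * (Fintype.card (Plaquette 3 L × Fin 3) : ℝ) * τu ^ 2 * ‖linkEmbed L v'‖ ^ 2) := by
  have hτu1 : τu ≤ 1 := hτu.trans (by norm_num)
  -- kinetic
  have hkin := timeCoupling_orthoTube_gauge_diag_sub (L := L) u g v v'
  have hkin2 := abs_diagKinetic_second_le (L := L) (fun k => vecPart (u (0, k))) (fun e => vecPart (g (e.1.shift e.2))) (fun e => vecPart (linkM L v v' g e))
  -- magnetic: the second differences at `v` and at `v'`
  have hm := abs_wilsonAction_orthoTube_second_diff (L := L) u hv hτ hσ hτu hS hvτ hu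
  have hm' := abs_wilsonAction_orthoTube_second_diff (L := L) u hv' hτ hσ hτu hS hvτ' hu
  -- the stiffness form at first order
  have hst := abs_stiffForm_sub_le (L := L) u hτu1 hu (linkEmbed L v)
  have hst' := abs_stiffForm_sub_le (L := L) u hτu1 hu (linkEmbed L v')
  -- algebra (lane A's split, with the magnetic remainders paired)
  have hsplit : diagX L β u v v' g - diagX1 L β (slowLin u) v v' g =
      β * (-(4 * ∑ e : Edge 3 L, (vecPart (u (0, e.2)) ⨯₃ (vecPart (u (0, e.2)) ⨯₃ vecPart (g (e.1.shift e.2)))) ⬝ᵥ vecPart (linkM L v v' g e))) -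
      β / 2 * (((wilsonAction su2Rep (orthoTube L u v) - (L : ℝ) ^ 3 * wilsonAction su2Rep u - ‖covCurl (constLift L u) (linkEmbed L v)‖ ^ 2) -
          (wilsonAction su2Rep (orthoTube L 1 v) - ‖covCurl (1 : GaugeConfig 3 L SU2) (linkEmbed L v)‖ ^ 2)) +
        (‖covCurl (constLift L u) (linkEmbed L v)‖ ^ 2 - ‖covCurl (1 : GaugeConfig 3 L SU2) (linkEmbed L v)‖ ^ 2 -
          2 * ⟪covCurl (1 : GaugeConfig 3 L SU2) (linkEmbed L v), covCurlLin (slowLin u) (linkEmbed L v)⟫)) -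
      β / 2 * (((wilsonAction su2Rep (orthoTube L u v') - (L : ℝ) ^ 3 * wilsonAction su2Rep u - ‖covCurl (constLift L u) (linkEmbed L v')‖ ^ 2) -
          (wilsonAction su2Rep (orthoTube L 1 v') - ‖covCurl (1 : GaugeConfig 3 L SU2) (linkEmbed L v')‖ ^ 2)) +
        (‖covCurl (constLift L u) (linkEmbed L v')‖ ^ 2 - ‖covCurl (1 : GaugeConfig 3 L SU2) (linkEmbed L v')‖ ^ 2 -
          2 * ⟪covCurl (1 : GaugeConfig 3 L SU2) (linkEmbed L v'), covCurlLin (slowLin u) (linkEmbed L v')⟫)) := by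
    unfold diagX diagX1
    rw [hkin]
    unfold linkM slowLin
    ring
  rw [hsplit]
  set K4 : ℝ := 4 * ∑ e : Edge 3 L, (vecPart (u (0, e.2)) ⨯₃ (vecPart (u (0, e.2)) ⨯₃ vecPart (g (e.1.shift e.2)))) ⬝ᵥ vecPart (linkM L v v' g e) with hK4
  set dv : ℝ := (wilsonAction su2Rep (orthoTube L u v) - (L : ℝ) ^ 3 * wilsonAction su2Rep u - ‖covCurl (constLift L u) (linkEmbed L v)‖ ^ 2) -
          (wilsonAction su2Rep (orthoTube L 1 v) - ‖covCurl (1 : GaugeConfig 3 L SU2) (linkEmbed L v)‖ ^ 2) with hdv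
  set pv : ℝ := ‖covCurl (constLift L u) (linkEmbed L v)‖ ^ 2 - ‖covCurl (1 : GaugeConfig 3 L SU2) (linkEmbed L v)‖ ^ 2 -
    2 * ⟪covCurl (1 : GaugeConfig 3 L SU2) (linkEmbed L v), covCurlLin (slowLin u) (linkEmbed L v)⟫ with hpv
  set dv' : ℝ := (wilsonAction su2Rep (orthoTube L u v') - (L : ℝ) ^ 3 * wilsonAction su2Rep u - ‖covCurl (constLift L u) (linkEmbed L v')‖ ^ 2) -
          (wilsonAction su2Rep (orthoTube L 1 v') - ‖covCurl (1 : GaugeConfig 3 L SU2) (linkEmbed L v')‖ ^ 2) with hdv'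
  set pv' : ℝ := ‖covCurl (constLift L u) (linkEmbed L v')‖ ^ 2 - ‖covCurl (1 : GaugeConfig 3 L SU2) (linkEmbed L v')‖ ^ 2 -
    2 * ⟪covCurl (1 : GaugeConfig 3 L SU2) (linkEmbed L v'), covCurlLin (slowLin u) (linkEmbed L v')⟫ with hpv'
  have hβ2 : 0 ≤ β / 2 := by linarith
  have h1 : |β * -K4| ≤ β * (48 * ∑ e : Edge 3 L, ‖vecPart (u (0, e.2))‖ ^ 2 * ‖vecPart (g (e.1.shift e.2))‖ * ‖vecPart (linkM L v v' g e)‖) := by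
    rw [abs_mul, abs_neg, abs_of_nonneg hβ]; exact mul_le_mul_of_nonneg_left hkin2 hβ
  have h2 : |β / 2 * (dv + pv)| ≤ β / 2 * (|dv| + |pv|) := by
    rw [abs_mul, abs_of_nonneg hβ2]; exact mul_le_mul_of_nonneg_left (abs_add_le _ _) hβ2
  have h3 : |β / 2 * (dv' + pv')| ≤ β / 2 * (|dv'| + |pv'|) := by
    rw [abs_mul, abs_of_nonneg hβ2]; exact mul_le_mul_of_nonneg_left (abs_add_le _ _) hβ2
  have htri : |β * -K4 - β / 2 * (dv + pv) - β / 2 * (dv' + pv')| ≤ |β * -K4| + |β / 2 * (dv + pv)| + |β / 2 * (dv' + pv')| := by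
    calc |β * -K4 - β / 2 * (dv + pv) - β / 2 * (dv' + pv')| ≤ |β * -K4 - β / 2 * (dv + pv)| + |β / 2 * (dv' + pv')| := abs_sub _ _
      _ ≤ |β * -K4| + |β / 2 * (dv + pv)| + |β / 2 * (dv' + pv')| := by linarith [abs_sub (β * -K4) (β / 2 * (dv + pv))]
  have hb2 := mul_le_mul_of_nonneg_left hm hβ2
  have hb2' := mul_le_mul_of_nonneg_left hm' hβ2
  have hd2 := mul_le_mul_of_nonneg_left hst hβ2
  have hd2' := mul_le_mul_of_nonneg_left hst' hβ2
  linarith [htri, h1, h2, h3, hb2, hb2', hd2, hd2']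

/-! ## §2 ★ Uniformly over the colour rotation -/

set_option maxHeartbeats 800000 in
/-- ★ **Second order WITHOUT junk, uniformly over the conjugates**: `|diagX β (dud⁻¹) v v′ g − diagX1 β (slowLin(dud⁻¹)) v v′ g| ≤ E₂'(p)` with the slow datum measured
rotation-invariantly by `Σ_a u⃗_{k,a}² ≤ τ_u²` (`τ_u ≤ 1/40`); the junk-free replacement of `abs_diagX_conj_sub_diagX1_le_E2`. [cite: Luscher1983, §3] -/
theorem abs_diagX_conj_sub_diagX1_le_E2' {β : ℝ} (hβ : 0 ≤ β) (u : GaugeConfig 3 1 SU2) {v v' : Edge 3 L → Fin 3 → ℝ} (hv : v ∈ capBalancedSet L) (hv' : v' ∈ capBalancedSet L)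
    {τ σ τu : ℝ} (hτ : τ ≤ 1 / 30) (hσ : σ < 2) (hσ0 : 0 ≤ σ) (hS : (L : ℝ) ^ 3 * wilsonAction su2Rep u ≤ σ)
    (hvτ : ∀ (e : Edge 3 L) (c : Fin 3), |v e c| ≤ τ) (hvτ' : ∀ (e : Edge 3 L) (c : Fin 3), |v' e c| ≤ τ) (hτu0 : 0 ≤ τu) (hτu : τu ≤ 1 / 40)
    (hu : ∀ k : Fin 3, ∑ a, vecPart (u (0, k)) a ^ 2 ≤ τu ^ 2) (g : Site 3 L → SU2) (d : SU2) :
    |diagX L β (gaugeTransform (fun _ : Site 3 1 => d) u) v v' g - diagX1 L β (slowLin (gaugeTransform (fun _ : Site 3 1 => d) u)) v v' g| ≤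
      β * (48 * ∑ e : Edge 3 L, τu ^ 2 * ‖vecPart (g (e.1.shift e.2))‖ * ‖vecPart (linkM L v v' g e)‖) +
      β / 2 * (σ / 2 * (10 * Real.sqrt (Fintype.card (Plaquette 3 L × Fin 3)) * ‖linkEmbed L v‖) ^ 2 +
        (Fintype.card (Plaquette 3 L) : ℝ) * (1728 * τ ^ 2 * Real.sqrt σ + σ / 2 * (29376 * τ ^ 3 + 700569 * τ ^ 4) + 700000 * τu * τ ^ 3) +
        145000000 * (Fintype.card (Plaquette 3 L × Fin 3) : ℝ) * τu ^ 2 * ‖linkEmbed L v‖ ^ 2) +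
      β / 2 * (σ / 2 * (10 * Real.sqrt (Fintype.card (Plaquette 3 L × Fin 3)) * ‖linkEmbed L v'‖) ^ 2 +
        (Fintype.card (Plaquette 3 L) : ℝ) * (1728 * τ ^ 2 * Real.sqrt σ + σ / 2 * (29376 * τ ^ 3 + 700569 * τ ^ 4) + 700000 * τu * τ ^ 3) +
        145000000 * (Fintype.card (Plaquette 3 L × Fin 3) : ℝ) * τu ^ 2 * ‖linkEmbed L v'‖ ^ 2) := by
  have hSd : (L : ℝ) ^ 3 * wilsonAction su2Rep (gaugeTransform (fun _ : Site 3 1 => d) u) ≤ σ := by rw [wilsonAction_gaugeTransform]; exact hS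
  have hud : ∀ (k : Fin 3) (a : Fin 3), |vecPart (gaugeTransform (fun _ : Site 3 1 => d) u (0, k)) a| ≤ τu := abs_vecPart_conj_apply_le hτu0 hu d
  have h := abs_diagX_sub_diagX1_le' (L := L) hβ (gaugeTransform (fun _ : Site 3 1 => d) u) hv hv' hτ hσ hSd hvτ hvτ' hτu hud g
  refine h.trans ?_
  set N : ℝ := (Fintype.card (Plaquette 3 L × Fin 3) : ℝ)
  have hn : ∀ e : Edge 3 L, ‖vecPart (gaugeTransform (fun _ : Site 3 1 => d) u (0, e.2))‖ ^ 2 ≤ τu ^ 2 := fun e =>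
    pow_le_pow_left₀ (norm_nonneg _) (norm_vecPart_conj_le hτu0 hu d e.2) 2
  have hs : ∑ e : Edge 3 L, ‖vecPart (gaugeTransform (fun _ : Site 3 1 => d) u (0, e.2))‖ ^ 2 * ‖vecPart (g (e.1.shift e.2))‖ * ‖vecPart (linkM L v v' g e)‖ ≤
      ∑ e : Edge 3 L, τu ^ 2 * ‖vecPart (g (e.1.shift e.2))‖ * ‖vecPart (linkM L v v' g e)‖ :=
    Finset.sum_le_sum fun e _ => mul_le_mul_of_nonneg_right (mul_le_mul_of_nonneg_right (hn e) (norm_nonneg _)) (norm_nonneg _)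
  have hD : ∀ w : LinkSpace L, ‖covCurl (constLift L (gaugeTransform (fun _ : Site 3 1 => d) u)) w‖ ^ 2 ≤ (10 * Real.sqrt N * ‖w‖) ^ 2 := fun w =>
    pow_le_pow_left₀ (norm_nonneg _) (norm_covCurl_le_op _ w) 2
  have hDv := hD (linkEmbed L v)
  have hDv' := hD (linkEmbed L v')
  have hβ2 : 0 ≤ β / 2 := by linarith
  have hσ4 : 0 ≤ σ / 2 := by linarith
  nlinarith [mul_le_mul_of_nonneg_left hs (by positivity : (0 : ℝ) ≤ β * 48), mul_le_mul_of_nonneg_left (mul_le_mul_of_nonneg_left hDv hσ4) hβ2,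
    mul_le_mul_of_nonneg_left (mul_le_mul_of_nonneg_left hDv' hσ4) hβ2]

end Summit.QuantumFields.YangMills.Theorems.FemtoTransferGap.RateTube

end
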